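import Summits.HodgeConjecture.HodgeConjecture.Theorems.MarkmanPartnerTransportPicardThreeK3SquaresZeta9TypeOfConj
import Summits.HodgeConjecture.HodgeConjecture.Theorems.MarkmanPartnerTransportPicardThreeK3SquaresSqrt2TypeOfConj
import Summits.HodgeConjecture.HodgeConjecture.Theorems.MarkmanPartnerTransportPartnerTransport
import HarnessLib

/-!
# Route MarkmanPartnerTransport · target `K3Sq2TypeHodge` on the partnered branch (`ρ(X) = 11`):
# HC⁴(X) for every `K3^{[2]}`-type fourfold whose K3 partner is of the ζ₉ or the √2 real-multiplication
# type — HYPOTHESIS-MINIMAL form (no annihilating polynomial, no Picard number; for ζ₉ no generation clause)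

Cell hodge-nonav; prover seat hodge-nonav-19652-p1 (gen 13); `--supports stmt-HodgeConjecture-19652`, helper.
Gen 12's `…Zeta9Sqrt2Partner` composes the K3-side theorems `exists_zeta9Type_hodgeConjectureFor_square` /
`exists_sqrt2Type_hodgeConjectureFor_square` with `PartnerLattice.partnerTransport_explicit`; its clause bundle
`PartnerHC[θ]` asks, on the K3 partner, an annihilating separable `P` with `P(0) ≠ 0` and the generation clause.
Gen 12's later K3-side upgrades `exists_zeta9Type_hodgeConjectureFor_square_of_conj` (`…Zeta9TypeOfConj`: marking +
rational conjugacy ONLY; `ρ(S) = 10`, the cubic and generation-or-CM all derived) and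
`exists_sqrt2Type_hodgeConjectureFor_square_of_conj` (`…Sqrt2TypeOfConj`: marking + conjugacy + generation clause;
`12 = 2·2·3` leaves the generation clause) are here carried to the `X` side:

* `PartnerHCConj[θ]` — HC⁴(X) for every marked smooth projective `K3^{[2]}`-type `(X, φ, P, z)` with a transcendental
  Hodge isometry `g_X : H²(S) → H²(X)` ((g1), (g2), (g5)) from a marked projective K3 surface `(S, η, p, x)` carrying
  `t` (rational, type-preserving, kills `N¹`, image `⊥ N¹`) conjugate by a rational isometry of `Λ_ℚ` to `θ_ℂ`;
  `PartnerHCConjGen[θ]` — the same with the generation clause `TranscendentalEndomorphismsGeneratedBy S t` kept;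
* **`exists_zeta9Type_hodgeConjectureFor_partner_of_conj`** — `∃` ζ₉ datum with `PartnerHCConj[θ]`
  (mod {Buskin, ζ₉ fact, marking fact, Buskin CM corollary, Beauville ×2, Markman lift, Voisin cup});
* **`exists_sqrt2Type_hodgeConjectureFor_partner_of_conj`** — `∃` √2 datum with `PartnerHCConjGen[θ]`
  (mod {Buskin, √2 fact, Beauville ×2, Markman lift, Voisin cup}).

These `X` (partners of Picard-`10` K3 surfaces) have `ρ(X) = 11`: the PARTNERED branch of the route's assembly for
the two maximal van Geemen–Schütt RM types at `ρ(S) = 10`, BY NAME with minimal hypotheses on the partner. Leaf file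
(`…PartnerTransport` imports the route file). CONDITIONAL on the displayed named facts ONLY; credits nothing;
neither the crux nor the target nor HC is proved here. No definition, no sorry.

References: van Geemen–Schütt, Forum Math. Sigma 13 (2025) e2, Thm. 1.1 (9), Thm. 1.2 (2), §5.6, Prop. 6.2, §6.4,
Rem. 6.5; E. Markman, Compos. Math. 160 (2024) Thm. 1.1, 1.4; A. Beauville, J. Differential Geom. 18 (1983) §6;
N. Buskin, J. reine angew. Math. 755 (2019) Thm. 1.1.
-/

set_option linter.dupNamespace false

noncomputable section

namespace Summit.HodgeConjecture.HodgeConjecture.Theorems.MarkmanPartnerTransport.RMTypeOrbit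

open CategoryTheory MonoidalCategory Polynomial
open Literature.AlgebraicGeometry Literature.AlgebraicGeometry.Motives Literature.AlgebraicGeometry.HodgeTheory
open Literature.AlgebraicGeometry.Surfaces Literature.LinearAlgebra.QuadraticForm
open Literature.AlgebraicGeometry.Hyperkaehler Literature.AlgebraicGeometry.HilbertScheme
open Literature.AlgebraicTopology.SingularHomology Literature.Geometry.Kaehler
open Summit.HodgeConjecture.HodgeConjecture.Theorems.NikulinTwinTransport
open Summit.HodgeConjecture.HodgeConjecture.Theorems.MarkmanPartnerTransport.IsogenyInvariance
open Summit.HodgeConjecture.HodgeConjecture.Theorems.MarkmanPartnerTransport.RMTypeDescent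

/-- `MarkedK3[S, η, p, x]`: VERBATIM the `let MarkedK3 := …` binder of the route declaration
`PicardThreeK3Squares` (as in `…RMTypeDescent`). Local notation only. -/
local notation3 (prettyPrint := false) "MarkedK3[" S ", " η ", " p ", " x "]" =>
  (p ≠ 0 ∧ (IsIntegralClass p ∧
    (∀ q : complexBetti S (2 * 2), IsIntegralClass q → ∃ n : ℤ, q = n • p) ∧
    (∀ c : complexBetti S (2 * 1), IsIntegralClass c ↔ ∃ v : K3Index → ℤ, η c = fun i => (v i : ℂ)) ∧
    (∀ a b : complexBetti S (2 * 1),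
      cupProduct (rfl : 2 * 1 + 2 * 1 = 2 * 2) a b = k3Form (η a) (η b) • p) ∧
    IsOfHodgeType 2 S (2 * 1) 2 0 (LinearEquiv.symm η x) ∧
    (∀ τ : complexBetti S (2 * 1), IsOfHodgeType 2 S (2 * 1) 2 0 τ →
      ∃ t : ℂ, τ = t • LinearEquiv.symm η x)) ∧
    (k3Form x x = 0 ∧ 0 < (k3Form (star x) x).re ∧
      ∃ u : K3Index → ℤ, k3Form (fun i => (u i : ℂ)) x = 0 ∧ 0 < ∑ i, ∑ j, u i * k3Gram i j * u j))

/-- `Zeta9Model[g, y₀, θ]`: VERBATIM the datum conjuncts of the named fact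
`VanGeemenSchuett2025_zeta9_cycleOnOpenPeriodSet` (as in `…Zeta9Type`). Local notation only. -/
local notation3 (prettyPrint := false) "Zeta9Model[" g ", " y₀ ", " θ "]" =>
  ((∀ a b : K3Index → ℂ, k3Form (g a) (g b) = k3Form a b) ∧
    (∀ v : K3Index → ℤ, ∃ w : K3Index → ℤ,
      g (fun i => ((v i : ℤ) : ℂ)) = fun i => ((w i : ℤ) : ℂ)) ∧
    g ^ 9 = 1 ∧
    Module.finrank ℂ (LinearMap.ker (g ^ 3 - 1)) = 10 ∧
    k3Form y₀ y₀ = 0 ∧ 0 < (k3Form (star y₀) y₀).re ∧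
    g y₀ = Complex.exp (2 * Real.pi * Complex.I / 9) • y₀ ∧
    (∀ y : K3Index → ℂ, thetaC θ y =
      (1 / 3 : ℂ) • ((2 : ℂ) • g y + (2 : ℂ) • (g ^ 8) y - (g ^ 2) y - (g ^ 4) y - (g ^ 5) y
        - (g ^ 7) y)))

/-- `Sqrt2Model[θ]`: VERBATIM the datum conjuncts of the named fact
`VanGeemenSchuett2025_sqrt2_cycleOnOpenPeriodSet` (as in `…Sqrt2Type`). Local notation only. -/
local notation3 (prettyPrint := false) "Sqrt2Model[" θ "]" =>
  ((∀ a b : K3Index → ℂ, k3Form (thetaC θ a) b = k3Form a (thetaC θ b)) ∧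
    Module.finrank ℂ (LinearMap.ker (thetaC θ)) = 10 ∧
    thetaC θ ^ 3 = (2 : ℂ) • thetaC θ)

/-- `MarkedK3Sq[X, φ, P, z]`: VERBATIM the `let MarkedK3Sq := …` binder of the route declarations of
MarkmanPartnerTransport (clauses (m1)–(m6)), as in `…PartnerTransport`. Local notation only. -/
local notation3 (prettyPrint := false) "MarkedK3Sq[" X ", " φ ", " P ", " z "]" =>
  (((IsIntegralClass P ∧ ∀ Q : complexBetti X (2 * 4), IsIntegralClass Q → ∃ n : ℤ, Q = n • P) ∧
    (∀ c : complexBetti X 2, IsIntegralClass c ↔ ∃ v : K3HilbertIndex → ℤ, φ c = fun i => (v i : ℂ)) ∧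
    (∀ a : complexBetti X 2, cupPowTwo a 4 = ((3 : ℂ) * (k3HilbertForm 2 (φ a) (φ a)) ^ 2) • P) ∧
    (IsOfHodgeType 4 X 2 2 0 (LinearEquiv.symm φ z) ∧
      ∀ τ : complexBetti X 2, IsOfHodgeType 4 X 2 2 0 τ → ∃ t : ℂ, τ = t • LinearEquiv.symm φ z) ∧
    (∀ c : complexBetti X 2, IsOfHodgeType 4 X 2 1 1 c ↔
      (k3HilbertForm 2 (φ c) z = 0 ∧ k3HilbertForm 2 (φ c) (star z) = 0)) ∧
    (k3HilbertForm 2 z z = 0 ∧ 0 < (k3HilbertForm 2 (star z) z).re)))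

/-- `PartnerHCConj[θ]`: **HC⁴ of every marked smooth projective `K3^{[2]}`-type fourfold with a K3 partner of
rational real-multiplication type `θ`, SLIM form** — as gen 12's `PartnerHC[θ]` but WITHOUT the annihilating
polynomial and WITHOUT the generation clause on the partner's endomorphism `t` (rational, type-preserving, killing
`N¹`, image `⊥ N¹`, conjugate by a rational isometry `σ` of `Λ_ℚ` to `θ_ℂ`). Local notation only. -/
local notation3 (prettyPrint := false) "PartnerHCConj[" θ "]" =>
  (∀ (X : SchemeOver ℂ) (_hX : IsSmoothProjective 4 X) (_hK : IsOfK3HilbertSquareType X)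
    (φ : complexBetti X 2 ≃ₗ[ℂ] (K3HilbertIndex → ℂ)) (PX : complexBetti X (2 * 4))
    (z : K3HilbertIndex → ℂ) (_hMX : MarkedK3Sq[X, φ, PX, z])
    (S : SchemeOver ℂ) (_hS : IsK3Surface S)
    (η : complexBetti S (2 * 1) ≃ₗ[ℂ] (K3Index → ℂ)) (p : complexBetti S (2 * 2)) (x : K3Index → ℂ)
    (_hM : MarkedK3[S, η, p, x])
    (t : complexBetti S (2 * 1) →ₗ[ℂ] complexBetti S (2 * 1))
    (_ht_rat : ∀ y, IsRationalClass y → IsRationalClass (t y))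
    (_ht_typ : ∀ (i j : ℕ) (y : complexBetti S (2 * 1)),
      IsOfHodgeType 2 S (2 * 1) i j y → IsOfHodgeType 2 S (2 * 1) i j (t y))
    (_ht_N : ∀ d ∈ algebraicClasses S 1, t d = 0)
    (_ht_perp : ∀ (y : complexBetti S (2 * 1)), ∀ d ∈ algebraicClasses S 1,
      cupProduct (rfl : 2 * 1 + 2 * 1 = 2 * 2) (t y) d = 0)
    (σ : Module.End ℂ (K3Index → ℂ)) (_hσ : ∀ a b, k3Form (σ a) (σ b) = k3Form a b)
    (_hσrat : ∀ v : K3Index → ℤ, ∃ w : K3Index → ℚ, σ (fun i => (v i : ℂ)) = fun i => (w i : ℂ))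
    (_hconj : ∀ c : complexBetti S (2 * 1), σ (η (t c)) = thetaC θ (σ (η c)))
    (gX : complexBetti S (2 * 1) →ₗ[ℂ] complexBetti X 2)
    (_hg1 : ∀ a, IsRationalClass a → IsRationalClass (gX a))
    (_hg2 : ∀ (i j : ℕ) a, IsOfHodgeType 2 S (2 * 1) i j a → IsOfHodgeType 4 X 2 i j (gX a))
    (_hg5 : ∀ a b, (∀ d ∈ algebraicClasses S 1, cupProduct (rfl : 2 * 1 + 2 * 1 = 2 * 2) a d = 0) →
      (∀ d ∈ algebraicClasses S 1, cupProduct (rfl : 2 * 1 + 2 * 1 = 2 * 2) b d = 0) →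
      k3HilbertForm 2 (φ (gX a)) (φ (gX b)) = k3Form (η a) (η b)),
    HodgeConjectureFor 4 X)

/-- `PartnerHCConjGen[θ]`: as `PartnerHCConj[θ]` with the generation clause
`TranscendentalEndomorphismsGeneratedBy S t` KEPT (the √2 type: `12 = 2·2·3`). Local notation only. -/
local notation3 (prettyPrint := false) "PartnerHCConjGen[" θ "]" =>
  (∀ (X : SchemeOver ℂ) (_hX : IsSmoothProjective 4 X) (_hK : IsOfK3HilbertSquareType X)
    (φ : complexBetti X 2 ≃ₗ[ℂ] (K3HilbertIndex → ℂ)) (PX : complexBetti X (2 * 4))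
    (z : K3HilbertIndex → ℂ) (_hMX : MarkedK3Sq[X, φ, PX, z])
    (S : SchemeOver ℂ) (_hS : IsK3Surface S)
    (η : complexBetti S (2 * 1) ≃ₗ[ℂ] (K3Index → ℂ)) (p : complexBetti S (2 * 2)) (x : K3Index → ℂ)
    (_hM : MarkedK3[S, η, p, x])
    (t : complexBetti S (2 * 1) →ₗ[ℂ] complexBetti S (2 * 1))
    (_ht_rat : ∀ y, IsRationalClass y → IsRationalClass (t y))
    (_ht_typ : ∀ (i j : ℕ) (y : complexBetti S (2 * 1)),
      IsOfHodgeType 2 S (2 * 1) i j y → IsOfHodgeType 2 S (2 * 1) i j (t y))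
    (_ht_N : ∀ d ∈ algebraicClasses S 1, t d = 0)
    (_ht_perp : ∀ (y : complexBetti S (2 * 1)), ∀ d ∈ algebraicClasses S 1,
      cupProduct (rfl : 2 * 1 + 2 * 1 = 2 * 2) (t y) d = 0)
    (_hgen : TranscendentalEndomorphismsGeneratedBy S t)
    (σ : Module.End ℂ (K3Index → ℂ)) (_hσ : ∀ a b, k3Form (σ a) (σ b) = k3Form a b)
    (_hσrat : ∀ v : K3Index → ℤ, ∃ w : K3Index → ℚ, σ (fun i => (v i : ℂ)) = fun i => (w i : ℂ))
    (_hconj : ∀ c : complexBetti S (2 * 1), σ (η (t c)) = thetaC θ (σ (η c)))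
    (gX : complexBetti S (2 * 1) →ₗ[ℂ] complexBetti X 2)
    (_hg1 : ∀ a, IsRationalClass a → IsRationalClass (gX a))
    (_hg2 : ∀ (i j : ℕ) a, IsOfHodgeType 2 S (2 * 1) i j a → IsOfHodgeType 4 X 2 i j (gX a))
    (_hg5 : ∀ a b, (∀ d ∈ algebraicClasses S 1, cupProduct (rfl : 2 * 1 + 2 * 1 = 2 * 2) a d = 0) →
      (∀ d ∈ algebraicClasses S 1, cupProduct (rfl : 2 * 1 + 2 * 1 = 2 * 2) b d = 0) →
      k3HilbertForm 2 (φ (gX a)) (φ (gX b)) = k3Form (η a) (η b)),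
    HodgeConjectureFor 4 X)

/-- **The partnered branch for the ζ₉ real-multiplication type, hypothesis-minimal: HC⁴ of every marked smooth
projective `K3^{[2]}`-type fourfold whose K3 partner carries an endomorphism `t` (rational, type-preserving,
kills `N¹`, image `⊥ N¹`) conjugate by a rational isometry of `Λ_ℚ` to the ζ₉ model `θ_ℂ`.** There is a ζ₉ datum
`(g, y₀, θ)` (as supplied by `VanGeemenSchuett2025_zeta9_cycleOnOpenPeriodSet`) with `PartnerHCConj[θ]`:
`HC⁴(S ⊗ S)` by `exists_zeta9Type_hodgeConjectureFor_square_of_conj` (`ρ(S) = 10`, the cubic `X³ - 3X + 1` and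
generation-or-CM are DERIVED there), then `PartnerLattice.partnerTransport_explicit`. These `X` have `ρ(X) = 11`.
CONDITIONAL on {`Buskin2019_hodgeIsometry_algebraic`, `VanGeemenSchuett2025_zeta9_cycleOnOpenPeriodSet`,
`Huybrechts_K3_marking_exists`, `Buskin2019_hodgeConjectureFor_square_of_CM`,
`Beauville1983_hilbertSquare_markedIncidence`, `Beauville1983_hilbertSquare_blowupDiagonal_surjection`,
`Markman2024_rationalHodgeIsometry_lift_algebraic_marked`, `Voisin2003_cupProduct_algebraicClasses`}; credits nothing;
neither the crux nor the target nor HC is proved here. [cite: GeemenSchutt2023, Thm. 1.1 (9), §4.8, §5.6]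
[cite: Markman2024, §1.1 Thm. 1.1 and Thm. 1.4] [cite: Beauville1983, §6 (e)–(f), Prop. 6]
[cite: Buskin2019, Thm. 1.1 and Corollary] -/
theorem exists_zeta9Type_hodgeConjectureFor_partner_of_conj
    (hB : Buskin2019_hodgeIsometry_algebraic) (hV : VanGeemenSchuett2025_zeta9_cycleOnOpenPeriodSet)
    (hmark : Huybrechts_K3_marking_exists) (hCM : Buskin2019_hodgeConjectureFor_square_of_CM)
    (hBI : Beauville1983_hilbertSquare_markedIncidence)
    (hBea : Beauville1983_hilbertSquare_blowupDiagonal_surjection)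
    (hMk : Markman2024_rationalHodgeIsometry_lift_algebraic_marked)
    (hcup : Voisin2003_cupProduct_algebraicClasses) :
    ∃ (g : Module.End ℂ (K3Index → ℂ)) (y₀ : K3Index → ℂ) (θ : Matrix K3Index K3Index ℚ),
      Zeta9Model[g, y₀, θ] ∧ PartnerHCConj[θ] := by
  obtain ⟨g, y₀, θ, hZ, hsq⟩ := exists_zeta9Type_hodgeConjectureFor_square_of_conj hB hV hmark hCM
  refine ⟨g, y₀, θ, hZ, ?_⟩
  intro X hX hK φ PX z hMX S hS η p x hM t ht_rat ht_typ ht_N ht_perp σ hσ hσrat hconj gX hg1 hg2 hg5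
  obtain ⟨hp0, hmk, hxx, hxpos, hu⟩ := hM
  exact PartnerLattice.partnerTransport_explicit hBI hBea hMk hcup hX hK hMX hS hmk hxx hxpos hu hg1 hg2 hg5
    (hsq S hS η p x ⟨hp0, hmk, hxx, hxpos, hu⟩ t ht_rat ht_typ ht_N ht_perp σ hσ hσrat hconj)

/-- **The partnered branch for the van Geemen–Schütt √2 real-multiplication type, hypothesis-minimal: HC⁴ of every
marked smooth projective `K3^{[2]}`-type fourfold whose K3 partner carries a GENERATING endomorphism `t` (rational,
type-preserving, kills `N¹`, image `⊥ N¹`) conjugate by a rational isometry of `Λ_ℚ` to the √2 model `θ_ℂ`.** There is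
a √2 datum `θ` (as supplied by `VanGeemenSchuett2025_sqrt2_cycleOnOpenPeriodSet`) with `PartnerHCConjGen[θ]`:
`HC⁴(S ⊗ S)` by `exists_sqrt2Type_hodgeConjectureFor_square_of_conj` (`ρ(S) = 10` and the quadratic `X² - 2`
are DERIVED there; the generation clause stays since `12 = 2·2·3`), then `PartnerLattice.partnerTransport_explicit`.
CONDITIONAL on {`Buskin2019_hodgeIsometry_algebraic`, `VanGeemenSchuett2025_sqrt2_cycleOnOpenPeriodSet`,
`Beauville1983_hilbertSquare_markedIncidence`, `Beauville1983_hilbertSquare_blowupDiagonal_surjection`,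
`Markman2024_rationalHodgeIsometry_lift_algebraic_marked`, `Voisin2003_cupProduct_algebraicClasses`}; credits nothing;
neither the crux nor the target nor HC is proved here. [cite: GeemenSchutt2023, Thm. 1.2 (2), Prop. 6.2, §6.4, Rem. 6.5]
[cite: Markman2024, §1.1 Thm. 1.1 and Thm. 1.4] [cite: Beauville1983, §6 (e)–(f), Prop. 6] [cite: Buskin2019, Thm. 1.1] -/
theorem exists_sqrt2Type_hodgeConjectureFor_partner_of_conj
    (hB : Buskin2019_hodgeIsometry_algebraic) (hV : VanGeemenSchuett2025_sqrt2_cycleOnOpenPeriodSet)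
    (hBI : Beauville1983_hilbertSquare_markedIncidence)
    (hBea : Beauville1983_hilbertSquare_blowupDiagonal_surjection)
    (hMk : Markman2024_rationalHodgeIsometry_lift_algebraic_marked)
    (hcup : Voisin2003_cupProduct_algebraicClasses) :
    ∃ θ : Matrix K3Index K3Index ℚ, Sqrt2Model[θ] ∧ PartnerHCConjGen[θ] := by
  obtain ⟨θ, hZ, hsq⟩ := exists_sqrt2Type_hodgeConjectureFor_square_of_conj hB hV
  refine ⟨θ, hZ, ?_⟩
  intro X hX hK φ PX z hMX S hS η p x hM t ht_rat ht_typ ht_N ht_perp hgen σ hσ hσrat hconj gX hg1 hg2 hg5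
  obtain ⟨hp0, hmk, hxx, hxpos, hu⟩ := hM
  exact PartnerLattice.partnerTransport_explicit hBI hBea hMk hcup hX hK hMX hS hmk hxx hxpos hu hg1 hg2 hg5
    (hsq S hS η p x ⟨hp0, hmk, hxx, hxpos, hu⟩ t ht_rat ht_typ ht_N ht_perp hgen σ hσ hσrat hconj)

end Summit.HodgeConjecture.HodgeConjecture.Theorems.MarkmanPartnerTransport.RMTypeOrbit

end
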